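import Summits.FinalStateConjecture.FinalStateConjecture.Theorems.EIHFluxBalanceInertialRecessionLorentz
import Literature.Geometry.Lorentzian.KerrEnergyIdentity

/-!
# Route EIHFluxBalance — `InertialRecession` (E′), line `SketchCleanExcision`, skeleton r13,
# stub `stub_firstOrderSlaving` (D), part 1: linear absorption and the kinematic dictionary

Helper file for the crux `stmt-FinalStateConjecture-17403`
(`Summit.FinalStateConjecture.FinalStateConjecture.Theses.EIHFluxBalance.InertialRecession`, E′),
stub `stub_firstOrderSlaving` (D) of skeleton r13 (first-order slaving of the painted moduli by
linear absorption of the momentum rows).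

* `firstOrder_absorb` — **the absorption step** (real variables only): if nonnegative sizes
  `redᵢ(t)` satisfy, for every `ε > 0`, eventually `c · redᵢ(t) ≤ ε (1 + Σⱼ redⱼ(t))` for all
  `i`, with `c > 0` fixed, then every `redᵢ → 0`.
* `firstOrder_hasDerivAt_frame_apply` — **the kinematic dictionary**: along a differentiable
  Lorentz path, `d/ds (Λ(s) v) = −Λ₀ (D (Λ₀ v))` with `D = d/ds Λ(s)⁻¹`, so the lab rates `u̇`,
  `ṅ` are read off the body rates `A e₀`, `A e₃` (`A = D ∘ Λ₀`).
* `firstOrder_norm_mismatch_le` — the velocity mismatch `ξ̇ − v(Λ)` is bounded by the spatial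
  part of the body datum `Λ⁻¹ ċ`, `ċ = (1, ξ̇)`.
* `firstOrder_first_of_tendsto` — hence decay of the three reduced body rates gives the
  conclusion `FIRST` of the stub (`u̇ → 0`, `ξ̇ − v → 0`, `a ≠ 0 → ṅ → 0`).

Elementary; no definitions, no named facts.
-/

set_option linter.dupNamespace false

noncomputable section

open scoped Topology BigOperators
open Filter Set Function Metric Literature.Geometry.Lorentzian
  Summit.FinalStateConjecture.FinalStateConjecture.Theorems

namespace Summit.FinalStateConjecture.FinalStateConjecture.Theorems.SublinearIsFree.Slaving

/-! ### Linear absorption -/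

/-- **Linear absorption.** Let `redᵢ : ℝ → ℝ` (`i` in a finite index type) be nonnegative and
`c > 0`. If for every `ε > 0` there is `T` with `c · redᵢ(t) ≤ ε (1 + Σⱼ redⱼ(t))` for all
`t ≥ T` and all `i`, then `redᵢ(t) → 0` for every `i` (sum over `i` and absorb:
`(c − nε) Σ red ≤ nε`). [folklore] -/
theorem firstOrder_absorb {ι : Type*} [Fintype ι] {red : ι → ℝ → ℝ} {c : ℝ} (hc : 0 < c)
    (hred : ∀ i t, 0 ≤ red i t)
    (h : ∀ ε : ℝ, 0 < ε → ∃ T : ℝ, ∀ t, T ≤ t → ∀ i, c * red i t ≤ ε * (1 + ∑ j, red j t))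
    (i : ι) : Tendsto (red i) atTop (𝓝 0) := by
  have hn : (0 : ℝ) < Fintype.card ι := by
    have : 0 < Fintype.card ι := Fintype.card_pos_iff.2 ⟨i⟩
    exact_mod_cast this
  set n : ℝ := (Fintype.card ι : ℝ) with hn'
  rw [Metric.tendsto_atTop]
  intro δ hδ
  set ε : ℝ := min (c / (2 * n)) (δ * c / (4 * n)) with hε
  have hε0 : 0 < ε := lt_min (by positivity) (by positivity)
  have hε1 : n * ε ≤ c / 2 := by
    have : ε ≤ c / (2 * n) := min_le_left _ _
    calc n * ε ≤ n * (c / (2 * n)) := mul_le_mul_of_nonneg_left this hn.le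
      _ = c / 2 := by field_simp
  have hε2 : n * ε ≤ δ * c / 4 := by
    have : ε ≤ δ * c / (4 * n) := min_le_right _ _
    calc n * ε ≤ n * (δ * c / (4 * n)) := mul_le_mul_of_nonneg_left this hn.le
      _ = δ * c / 4 := by field_simp
  obtain ⟨T, hT⟩ := h ε hε0
  refine ⟨T, fun t ht ↦ ?_⟩
  set S : ℝ := ∑ j, red j t with hS
  have hS0 : 0 ≤ S := Finset.sum_nonneg fun j _ ↦ hred j t
  have hsum : c * S ≤ n * ε * (1 + S) := by
    calc c * S = ∑ j, c * red j t := by rw [hS, Finset.mul_sum]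
      _ ≤ ∑ _j : ι, ε * (1 + S) := Finset.sum_le_sum fun j _ ↦ hT t ht j
      _ = n * ε * (1 + S) := by
          rw [Finset.sum_const, Finset.card_univ, nsmul_eq_mul, hn']
          ring
  have hS1 : S ≤ δ / 2 := by
    have h1 : (c / 2) * S ≤ n * ε := by nlinarith
    have h2 : S ≤ 2 * (n * ε) / c := by
      rw [le_div_iff₀ hc]
      linarith
    calc S ≤ 2 * (n * ε) / c := h2
      _ ≤ 2 * (δ * c / 4) / c := by gcongr
      _ = δ / 2 := by field_simp; ring
  have hi : red i t ≤ S :=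
    Finset.single_le_sum (f := fun j ↦ red j t) (fun j _ ↦ hred j t) (Finset.mem_univ i)
  rw [Real.dist_eq, sub_zero, abs_of_nonneg (hred i t)]
  linarith

/-! ### The kinematic dictionary -/

section Kinematics

variable {Λ : ℝ → lorentzGroup} {s₀ : ℝ} {L' D : E4 →L[ℝ] E4}

/-- **Lab rates from body rates**: if `s ↦ Λ(s)` (as operators) has derivative `L'` and
`s ↦ Λ(s)⁻¹` has derivative `D` at `s₀`, then `L' v = −Λ₀ (D (Λ₀ v))` (differentiate
`Λ(s)⁻¹ (Λ(s) v) = v`). [folklore] -/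
theorem firstOrder_frame_deriv_apply
    (hΛ : HasDerivAt (fun s ↦ ((Λ s : E4 ≃L[ℝ] E4) : E4 →L[ℝ] E4)) L' s₀)
    (hΛi : HasDerivAt (fun s ↦ (((Λ s : E4 ≃L[ℝ] E4).symm : E4 →L[ℝ] E4))) D s₀) (v : E4) :
    L' v = -((Λ s₀ : E4 ≃L[ℝ] E4) (D ((Λ s₀ : E4 ≃L[ℝ] E4) v))) := by
  have hv : HasDerivAt (fun s ↦ ((Λ s : E4 ≃L[ℝ] E4) : E4 →L[ℝ] E4) v) (L' v) s₀ := by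
    simpa using hΛ.clm_apply (hasDerivAt_const s₀ v)
  have h := hΛi.clm_apply hv
  have hconst : (fun s ↦ (((Λ s : E4 ≃L[ℝ] E4).symm : E4 →L[ℝ] E4))
      (((Λ s : E4 ≃L[ℝ] E4) : E4 →L[ℝ] E4) v)) = fun _ ↦ v := by
    funext s
    simp
  rw [hconst] at h
  have h0 := (hasDerivAt_const s₀ v).unique h
  -- `0 = D (Λ₀ v) + Λ₀⁻¹ (L' v)`
  have h1 : (((Λ s₀ : E4 ≃L[ℝ] E4).symm : E4 →L[ℝ] E4)) (L' v) =
      -D (((Λ s₀ : E4 ≃L[ℝ] E4) : E4 →L[ℝ] E4) v) := by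
    rw [eq_neg_iff_add_eq_zero, add_comm]
    exact h0.symm
  have h2 := congrArg (Λ s₀ : E4 ≃L[ℝ] E4) h1
  simpa using h2

/-- **`‖d/ds (Λ v)‖ ≤ ‖Λ₀‖ ‖A (Λ₀⁻¹ Λ₀ v)‖`-type bound**: with `A = D ∘ Λ₀`,
`‖deriv (s ↦ Λ(s) v) s₀‖ ≤ ‖Λ₀‖ · ‖D (Λ₀ v)‖`. [folklore] -/
theorem firstOrder_norm_deriv_frame_apply_le
    (hΛ : DifferentiableAt ℝ (fun s ↦ ((Λ s : E4 ≃L[ℝ] E4) : E4 →L[ℝ] E4)) s₀)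
    (hΛi : HasDerivAt (fun s ↦ (((Λ s : E4 ≃L[ℝ] E4).symm : E4 →L[ℝ] E4))) D s₀) (v : E4) :
    ‖deriv (fun s ↦ ((Λ s : E4 ≃L[ℝ] E4) : E4 →L[ℝ] E4) v) s₀‖ ≤
      ‖((Λ s₀ : E4 ≃L[ℝ] E4) : E4 →L[ℝ] E4)‖ * ‖D ((Λ s₀ : E4 ≃L[ℝ] E4) v)‖ := by
  have hL := hΛ.hasDerivAt
  have hv : HasDerivAt (fun s ↦ ((Λ s : E4 ≃L[ℝ] E4) : E4 →L[ℝ] E4) v)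
      (deriv (fun s ↦ ((Λ s : E4 ≃L[ℝ] E4) : E4 →L[ℝ] E4)) s₀ v) s₀ := by
    simpa using hL.clm_apply (hasDerivAt_const s₀ v)
  rw [hv.deriv, firstOrder_frame_deriv_apply hL hΛi v, norm_neg]
  exact ((Λ s₀ : E4 ≃L[ℝ] E4) : E4 →L[ℝ] E4).le_opNorm _

end Kinematics

/-- **The velocity mismatch is the spatial part of the body datum.** For `Λ ∈ O(1,3)` with
`u = Λ e₀` and any `ξ' ∈ E3`:
`‖ξ' − (u⁰)⁻¹ u~‖ ≤ ‖(Λ⁻¹ (1, ξ'))~‖` — because `Λ⁻¹ (1, v(Λ)) = (u⁰)⁻¹ e₀` has no spatial part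
and `Λ⁻¹` does not shrink spatial vectors (`norm_le_spatialNorm_lorentz_apply`). [folklore] -/
theorem firstOrder_norm_mismatch_le (Λ : lorentzGroup) (ξ' : E3) :
    ‖ξ' - (((Λ : E4 ≃L[ℝ] E4) (E4.basisVector 0)) 0)⁻¹ •
        E4.spatial ((Λ : E4 ≃L[ℝ] E4) (E4.basisVector 0))‖ ≤
      ‖E4.spatial ((Λ : E4 ≃L[ℝ] E4).symm (E4.ofTimeSpace 1 ξ'))‖ := by
  set u : E4 := (Λ : E4 ≃L[ℝ] E4) (E4.basisVector 0) with hu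
  set v : E3 := (u 0)⁻¹ • E4.spatial u with hv
  have hu0 : u 0 ≠ 0 := fun h ↦
    absurd (one_le_abs_lorentz_apply_zero Λ) (by rw [← hu, h, abs_zero]; norm_num)
  -- `(1, v) = (u⁰)⁻¹ u`
  have h1v : E4.ofTimeSpace 1 v = (u 0)⁻¹ • u := by
    ext i
    refine Fin.cases ?_ (fun j ↦ ?_) i
    · simp [inv_mul_cancel₀ hu0]
    · simp [hv, E4.spatial_apply]
  -- `Λ⁻¹ (1, v) = (u⁰)⁻¹ e₀`, no spatial part
  have h2 : E4.spatial ((Λ : E4 ≃L[ℝ] E4).symm (E4.ofTimeSpace 1 v)) = 0 := by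
    rw [h1v, map_smul, hu, ContinuousLinearEquiv.symm_apply_apply, map_smul]
    have : E4.spatial (E4.basisVector 0) = 0 := by
      ext i; simp [E4.spatial_apply, Fin.succ_ne_zero]
    rw [this, smul_zero]
  -- the difference `(0, ξ' − v)` is spatial
  set w : E4 := E4.ofTimeSpace 0 (ξ' - v) with hw
  have hw0 : w 0 = 0 := by simp [hw]
  have hwdiff : E4.ofTimeSpace 1 ξ' = E4.ofTimeSpace 1 v + w := by
    ext i
    refine Fin.cases ?_ (fun j ↦ ?_) i
    · simp [hw]
    · simp [hw]
  have hnw : ‖w‖ = ‖ξ' - v‖ := by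
    rw [norm_eq_spatialNorm_of_apply_zero_eq_zero hw0, hw, E4.spatialNorm_ofTimeSpace]
  have h3 : E4.spatial ((Λ : E4 ≃L[ℝ] E4).symm (E4.ofTimeSpace 1 ξ')) =
      E4.spatial ((Λ : E4 ≃L[ℝ] E4).symm w) := by
    rw [hwdiff, map_add, map_add, h2, zero_add]
  rw [h3, ← hnw]
  have h4 := norm_le_spatialNorm_lorentz_apply Λ⁻¹ hw0
  rwa [coe_lorentz_inv] at h4

/-- The centre event `s ↦ (s, ξ(s))` has derivative `(1, ξ̇)` along a differentiable centre.
[folklore] -/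
theorem firstOrder_hasDerivAt_centreEvent {ξ : ℝ → E3} {ξ' : E3} {s₀ : ℝ}
    (hξ : HasDerivAt ξ ξ' s₀) :
    HasDerivAt (fun s ↦ E4.ofTimeSpace s (ξ s)) (E4.ofTimeSpace 1 ξ') s₀ := by
  have h : (fun s ↦ E4.ofTimeSpace s (ξ s)) = fun s ↦ s • E4.basisVector 0 + E4.spaceEmbed (ξ s) :=
    funext fun s ↦ E4.ofTimeSpace_eq_smul_add' _ _
  rw [h, E4.ofTimeSpace_eq_smul_add']
  exact ((hasDerivAt_id s₀).smul_const (E4.basisVector 0)).add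
    (E4.spaceEmbed.hasFDerivAt.comp_hasDerivAt s₀ hξ)

/-- **Decay of the reduced body rates gives the conclusion `FIRST` of the stub.** Along a
differentiable painted motion `(Λ(t), ξ(t))` with Lorentz factors `≤ γ`, if the body rates
`‖D_t (Λ_t e₀)‖`, the spatial part of the body datum `‖(Λ_t⁻¹ ċ(t))~‖` and (for `a ≠ 0`)
`‖D_t (Λ_t e₃)‖` tend to `0` (`D_t = d/ds Λ(s)⁻¹ |_{s=t}`, `ċ = (1, ξ̇)`), then `u̇ → 0`,
`ξ̇ − v(Λ) → 0` and (for `a ≠ 0`) `ṅ → 0`. [folklore] -/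
theorem firstOrder_first_of_tendsto {Λ : ℝ → lorentzGroup} {ξ : ℝ → E3} {γ a : ℝ}
    (hγ : ∀ t, |((Λ t : E4 ≃L[ℝ] E4) (E4.basisVector 0)) 0| ≤ γ)
    (hΛ : Differentiable ℝ (fun t ↦ ((Λ t : E4 ≃L[ℝ] E4) : E4 →L[ℝ] E4)))
    (hΛi : Differentiable ℝ (fun t ↦ (((Λ t : E4 ≃L[ℝ] E4).symm : E4 →L[ℝ] E4))))
    (hξ : Differentiable ℝ ξ)
    (h0 : Tendsto (fun t ↦ ‖deriv (fun s ↦ (((Λ s : E4 ≃L[ℝ] E4).symm : E4 →L[ℝ] E4))) t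
      ((Λ t : E4 ≃L[ℝ] E4) (E4.basisVector 0))‖) atTop (𝓝 0))
    (h1 : Tendsto (fun t ↦ ‖E4.spatial ((((Λ t : E4 ≃L[ℝ] E4).symm : E4 →L[ℝ] E4))
      (deriv (fun s ↦ E4.ofTimeSpace s (ξ s)) t))‖) atTop (𝓝 0))
    (h3 : a ≠ 0 → Tendsto (fun t ↦ ‖deriv (fun s ↦ (((Λ s : E4 ≃L[ℝ] E4).symm : E4 →L[ℝ] E4))) t
      ((Λ t : E4 ≃L[ℝ] E4) (E4.basisVector 3))‖) atTop (𝓝 0)) :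
    Tendsto (fun t ↦ iteratedDeriv 1 (fun s ↦ (((Λ s : lorentzGroup) : E4 ≃L[ℝ] E4)
        (E4.basisVector 0))) t) atTop (𝓝 0) ∧
      Tendsto (fun t ↦ iteratedDeriv 0 (fun s ↦ deriv ξ s -
        (((((Λ s : lorentzGroup) : E4 ≃L[ℝ] E4) (E4.basisVector 0)) 0)⁻¹ •
          E4.spatial (((Λ s : lorentzGroup) : E4 ≃L[ℝ] E4) (E4.basisVector 0)))) t)
        atTop (𝓝 0) ∧
      (a ≠ 0 → Tendsto (fun t ↦ iteratedDeriv 1 (fun s ↦ (((Λ s : lorentzGroup) : E4 ≃L[ℝ] E4)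
        (E4.basisVector 3))) t) atTop (𝓝 0)) := by
  have hγ1 : ∀ t, ‖((Λ t : E4 ≃L[ℝ] E4) : E4 →L[ℝ] E4)‖ ≤ 1 + 3 * γ := fun t ↦
    (norm_lorentz_le (Λ t)).trans (by linarith [hγ t])
  have hG : 0 ≤ 1 + 3 * γ := (norm_nonneg _).trans (hγ1 0)
  -- lab rates of a frame vector
  have hrate : ∀ (v : E4),
      Tendsto (fun t ↦ ‖deriv (fun s ↦ (((Λ s : E4 ≃L[ℝ] E4).symm : E4 →L[ℝ] E4))) t
        ((Λ t : E4 ≃L[ℝ] E4) v)‖) atTop (𝓝 0) →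
      Tendsto (fun t ↦ iteratedDeriv 1 (fun s ↦ (((Λ s : lorentzGroup) : E4 ≃L[ℝ] E4) v)) t)
        atTop (𝓝 0) := by
    intro v hv
    rw [iteratedDeriv_one]
    have h := hv.const_mul (1 + 3 * γ)
    rw [mul_zero] at h
    have h' : Tendsto (fun t ↦ ‖((Λ t : E4 ≃L[ℝ] E4) : E4 →L[ℝ] E4)‖ *
        ‖deriv (fun s ↦ (((Λ s : E4 ≃L[ℝ] E4).symm : E4 →L[ℝ] E4))) t ((Λ t : E4 ≃L[ℝ] E4) v)‖)
        atTop (𝓝 0) :=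
      squeeze_zero (fun t ↦ by positivity)
        (fun t ↦ mul_le_mul_of_nonneg_right (hγ1 t) (norm_nonneg _)) h
    exact squeeze_zero_norm
      (fun t ↦ firstOrder_norm_deriv_frame_apply_le (hΛ t) (hΛi t).hasDerivAt v) h'
  refine ⟨hrate _ h0, ?_, fun ha ↦ hrate _ (h3 ha)⟩
  rw [iteratedDeriv_zero]
  refine squeeze_zero_norm (fun t ↦ ?_) h1
  have hd : deriv (fun s ↦ E4.ofTimeSpace s (ξ s)) t = E4.ofTimeSpace 1 (deriv ξ t) :=
    (firstOrder_hasDerivAt_centreEvent (hξ t).hasDerivAt).deriv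
  rw [hd]
  exact firstOrder_norm_mismatch_le (Λ t) (deriv ξ t)

/-- **Registered one-line carrier form** (`firstOrder_absorb_D1`, stub (D) of the crux item) of
`firstOrder_absorb`: linear absorption of uniformly small relative bounds. [folklore] -/
theorem firstOrder_absorb_D1 : ∀ {ι : Type} [Fintype ι] {red : ι → ℝ → ℝ} {c : ℝ}, 0 < c → (∀ i t, 0 ≤ red i t) → (∀ ε : ℝ, 0 < ε → ∃ T : ℝ, ∀ t, T ≤ t → ∀ i, c * red i t ≤ ε * (1 + ∑ j, red j t)) → ∀ i : ι, Filter.Tendsto (red i) Filter.atTop (nhds 0) :=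
  fun hc hred h i ↦ firstOrder_absorb hc hred h i

end Summit.FinalStateConjecture.FinalStateConjecture.Theorems.SublinearIsFree.Slaving

end
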